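import Mathlib
import Literature.Analysis.FluidPDE.Tao2016AveragedNS.RestartedCascadeFlows
import HarnessLib

/-!
# `GappedFrontRobust`, the (step) clause: SELECTION LEMMAS for the constants of the K_B₂ assembly
  (helper for item stmt-NavierStokesRegularity-22114 `GappedFrontRobustV2`)

HONEST FRAMING: elementary real-number lemmas ("eventually small" for `q^{s n}` as `n → −∞` / `q^{−s n}` as
`n → +∞`, `q > 1`) and the first selection of the K_B₂ constants worksheet (architecture memo §7/§8, STEP 1):
the threshold `kb` behind the front from which the drift condition of `pseudoFlowOn_block_and_behind` /
`pseudoFlowOn_behind_tameness` holds for tame data `G k = C_G (1 + q^{−k})`. Nothing is asserted about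
any table or flow; nothing here concerns the Navier–Stokes equations.

* `exists_rpow_mul_le_atBot` — `q > 1`, `s > 0`, `ε > 0` ⇒ `∃ N, ∀ n ≤ N, q^{s n} ≤ ε` (integers `n`);
* `exists_rpow_neg_mul_le_atTop` — `q > 1`, `s > 0`, `ε > 0` ⇒ `∃ N, ∀ n ≥ N, q^{−(s n)} ≤ ε`;
* `exists_kb_behind_condition` — for `q > 1`, `C_G > 0`, `E₁, τ, Cα ≥ 0` there is `kb ≤ −1` with
  `τ · (2 Cα q^{5n/2} Ĝ n · Ĝ n) ≤ G n / 2` for all `n ≤ kb`, where `G n = C_G (1 + q^{−n})` and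
  `Ĝ n = 3 C_G (1 + q^{1−n}) + 2 √E₁` (the envelope of the three neighbours, inflated by the block bound).
-/

noncomputable section

-- the sub-problem namespace `Summit.NavierStokesRegularity.NavierStokesRegularity` repeats the summit name by design (D-0017)
set_option linter.dupNamespace false

namespace Summit.NavierStokesRegularity.NavierStokesRegularity.Theorems

open Set Literature.Analysis.FluidPDE Literature.Analysis.FluidPDE.TaoCascade

namespace GappedFrontRobust

/-- **Eventually small towards `−∞`**: for `q > 1`, `s > 0`, `ε > 0` there is `N` with `q^{s n} ≤ ε` for all
integers `n ≤ N`. [folklore] -/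
theorem exists_rpow_mul_le_atBot {q s ε : ℝ} (hq : 1 < q) (hs : 0 < s) (hε : 0 < ε) :
    ∃ N : ℤ, ∀ n : ℤ, n ≤ N → q ^ (s * n) ≤ ε := by
  have hq0 : 0 < q := by linarith
  -- (q^s)⁻¹ < 1, so its powers get below ε
  have hb : (q ^ s)⁻¹ < 1 := inv_lt_one_of_one_lt₀ (Real.one_lt_rpow hq hs)
  have hb0 : 0 < (q ^ s)⁻¹ := inv_pos.mpr (Real.rpow_pos_of_pos hq0 s)
  obtain ⟨k, hk⟩ := exists_pow_lt_of_lt_one hε hb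
  refine ⟨-(k : ℤ), fun n hn => ?_⟩
  have hn' : (n : ℝ) ≤ -(k : ℝ) := by exact_mod_cast hn
  -- q^{s n} ≤ q^{s (-k)} = ((q^s)⁻¹)^k
  have h1 : q ^ (s * n) ≤ q ^ (s * (-(k : ℝ))) :=
    Real.rpow_le_rpow_of_exponent_le hq.le (by nlinarith)
  have h2 : q ^ (s * (-(k : ℝ))) = ((q ^ s)⁻¹) ^ k := by
    rw [show s * (-(k : ℝ)) = -(s * k) by ring, Real.rpow_neg hq0.le, Real.rpow_mul_natCast hq0.le,
      inv_pow]
  linarith [h2 ▸ h1]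

/-- **Eventually small towards `+∞`**: for `q > 1`, `s > 0`, `ε > 0` there is `N` with `q^{−(s n)} ≤ ε` for
all integers `n ≥ N`. [folklore] -/
theorem exists_rpow_neg_mul_le_atTop {q s ε : ℝ} (hq : 1 < q) (hs : 0 < s) (hε : 0 < ε) :
    ∃ N : ℤ, ∀ n : ℤ, N ≤ n → q ^ (-(s * n)) ≤ ε := by
  obtain ⟨N, hN⟩ := exists_rpow_mul_le_atBot hq hs hε
  refine ⟨-N, fun n hn => ?_⟩
  have := hN (-n) (by linarith)
  push_cast at this
  rwa [show s * -(n : ℝ) = -(s * n) by ring] at this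

/-- **Selection of the behind threshold `kb`.** For `q > 1`, `C_G > 0`, `E₁, τ, Cα ≥ 0` there is
`kb ≤ −1` such that for every `n ≤ kb`,
`τ · (2 Cα q^{5n/2} Ĝ n Ĝ n) ≤ G n / 2` with `G n = C_G (1 + q^{−n})`, `Ĝ n = 3 C_G (1 + q^{1−n}) + 2√E₁`
(the rates `q^{5n/2}` beat the squared tame envelope `≍ q^{−2n}` by `q^{n/2} → 0` as `n → −∞`).
[folklore] -/
theorem exists_kb_behind_condition {q C_G E₁ τ Cα : ℝ} (hq : 1 < q) (hC : 0 < C_G) (hE : 0 ≤ E₁)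
    (hτ : 0 ≤ τ) (hCα : 0 ≤ Cα) :
    ∃ kb : ℤ, kb ≤ -1 ∧ ∀ n : ℤ, n ≤ kb →
      τ * (2 * Cα * q ^ ((5 : ℝ) * n / 2) * (3 * C_G * (1 + q ^ ((1 : ℝ) - n)) + 2 * Real.sqrt E₁) *
        (3 * C_G * (1 + q ^ ((1 : ℝ) - n)) + 2 * Real.sqrt E₁)) ≤ C_G * (1 + q ^ (-(n : ℝ))) / 2 := by
  have hq0 : 0 < q := by linarith
  have hq1 : 1 ≤ q := hq.le
  -- the constant K with LHS ≤ K q^{n/2} for n ≤ -1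
  set K : ℝ := τ * (4 * Cα * (36 * C_G ^ 2 * q ^ 2 + 4 * E₁)) with hK
  have hK0 : 0 ≤ K := by positivity
  obtain ⟨N, hN⟩ := exists_rpow_mul_le_atBot hq (by norm_num : (0 : ℝ) < 1 / 2)
    (div_pos hC (by positivity : (0 : ℝ) < 2 * (K + 1)))
  refine ⟨min N (-1), min_le_right _ _, fun n hn => ?_⟩
  have hnN : n ≤ N := hn.trans (min_le_left _ _)
  have hn1 : n ≤ -1 := hn.trans (min_le_right _ _)
  have hnr : (n : ℝ) ≤ -1 := by exact_mod_cast hn1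
  -- basic powers
  have hpn : 0 < q ^ (-(n : ℝ)) := Real.rpow_pos_of_pos hq0 _
  have hp1n : q ^ ((1 : ℝ) - n) = q * q ^ (-(n : ℝ)) := by
    rw [show (1 : ℝ) - n = 1 + (-(n : ℝ)) by ring, Real.rpow_add hq0, Real.rpow_one]
  have hone : (1 : ℝ) ≤ q ^ (-(n : ℝ)) := Real.one_le_rpow hq1 (by linarith)
  -- Ĝ ≤ 6 C_G q · q^{-n} + 2 √E₁  (using 1 + q^{1-n} ≤ 2 q q^{-n})
  have hG1 : 1 + q ^ ((1 : ℝ) - n) ≤ 2 * q * q ^ (-(n : ℝ)) := by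
    rw [hp1n]; nlinarith
  have hĜ : 3 * C_G * (1 + q ^ ((1 : ℝ) - n)) + 2 * Real.sqrt E₁ ≤
      6 * C_G * q * q ^ (-(n : ℝ)) + 2 * Real.sqrt E₁ := by nlinarith
  have hĜ0 : 0 ≤ 3 * C_G * (1 + q ^ ((1 : ℝ) - n)) + 2 * Real.sqrt E₁ := by
    have := Real.rpow_pos_of_pos hq0 ((1 : ℝ) - n); positivity
  -- square: Ĝ² ≤ 2 (36 C_G² q² q^{-2n} + 4 E₁)
  have hsqE : Real.sqrt E₁ ^ 2 = E₁ := Real.sq_sqrt hE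
  have hĜsq : (3 * C_G * (1 + q ^ ((1 : ℝ) - n)) + 2 * Real.sqrt E₁) *
      (3 * C_G * (1 + q ^ ((1 : ℝ) - n)) + 2 * Real.sqrt E₁) ≤
      72 * C_G ^ 2 * q ^ 2 * (q ^ (-(n : ℝ))) ^ 2 + 8 * E₁ := by
    have h1 : (3 * C_G * (1 + q ^ ((1 : ℝ) - n)) + 2 * Real.sqrt E₁) *
        (3 * C_G * (1 + q ^ ((1 : ℝ) - n)) + 2 * Real.sqrt E₁) ≤
        (6 * C_G * q * q ^ (-(n : ℝ)) + 2 * Real.sqrt E₁) ^ 2 := by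
      rw [sq]; exact mul_le_mul hĜ hĜ hĜ0 (hĜ0.trans hĜ)
    have h2 : (6 * C_G * q * q ^ (-(n : ℝ)) + 2 * Real.sqrt E₁) ^ 2 ≤
        2 * (6 * C_G * q * q ^ (-(n : ℝ))) ^ 2 + 2 * (2 * Real.sqrt E₁) ^ 2 := by
      nlinarith [sq_nonneg (6 * C_G * q * q ^ (-(n : ℝ)) - 2 * Real.sqrt E₁)]
    nlinarith [hsqE]
  -- q^{5n/2} (q^{-n})² = q^{n/2} and q^{5n/2} ≤ q^{n/2}
  have hpow1 : q ^ ((5 : ℝ) * n / 2) * (q ^ (-(n : ℝ))) ^ 2 = q ^ ((1 / 2 : ℝ) * n) := by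
    rw [← Real.rpow_mul_natCast hq0.le, ← Real.rpow_add hq0]; push_cast; ring_nf
  have hpow2 : q ^ ((5 : ℝ) * n / 2) ≤ q ^ ((1 / 2 : ℝ) * n) :=
    Real.rpow_le_rpow_of_exponent_le hq1 (by nlinarith)
  have hp5 : 0 ≤ q ^ ((5 : ℝ) * n / 2) := (Real.rpow_pos_of_pos hq0 _).le
  have hhalf : 0 ≤ q ^ ((1 / 2 : ℝ) * n) := (Real.rpow_pos_of_pos hq0 _).le
  -- LHS ≤ K q^{n/2}
  have hL : τ * (2 * Cα * q ^ ((5 : ℝ) * n / 2) * (3 * C_G * (1 + q ^ ((1 : ℝ) - n)) + 2 * Real.sqrt E₁) *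
      (3 * C_G * (1 + q ^ ((1 : ℝ) - n)) + 2 * Real.sqrt E₁)) ≤ K * q ^ ((1 / 2 : ℝ) * n) := by
    calc τ * (2 * Cα * q ^ ((5 : ℝ) * n / 2) * (3 * C_G * (1 + q ^ ((1 : ℝ) - n)) + 2 * Real.sqrt E₁) *
          (3 * C_G * (1 + q ^ ((1 : ℝ) - n)) + 2 * Real.sqrt E₁))
        = τ * (2 * Cα * q ^ ((5 : ℝ) * n / 2) * ((3 * C_G * (1 + q ^ ((1 : ℝ) - n)) + 2 * Real.sqrt E₁) *
          (3 * C_G * (1 + q ^ ((1 : ℝ) - n)) + 2 * Real.sqrt E₁))) := by ring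
      _ ≤ τ * (2 * Cα * q ^ ((5 : ℝ) * n / 2) *
          (72 * C_G ^ 2 * q ^ 2 * (q ^ (-(n : ℝ))) ^ 2 + 8 * E₁)) := by gcongr
      _ = τ * (2 * Cα) * (72 * C_G ^ 2 * q ^ 2 * (q ^ ((5 : ℝ) * n / 2) * (q ^ (-(n : ℝ))) ^ 2) +
          8 * E₁ * q ^ ((5 : ℝ) * n / 2)) := by ring
      _ ≤ τ * (2 * Cα) * (72 * C_G ^ 2 * q ^ 2 * q ^ ((1 / 2 : ℝ) * n) +
          8 * E₁ * q ^ ((1 / 2 : ℝ) * n)) := by rw [hpow1]; gcongr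
      _ = K * q ^ ((1 / 2 : ℝ) * n) := by simp only [hK]; ring
  -- K q^{n/2} ≤ C_G/2 ≤ RHS
  have hsmall := hN n hnN
  have hKq : K * q ^ ((1 / 2 : ℝ) * n) ≤ C_G / 2 := by
    calc K * q ^ ((1 / 2 : ℝ) * n) ≤ (K + 1) * q ^ ((1 / 2 : ℝ) * n) := by nlinarith
      _ ≤ (K + 1) * (C_G / (2 * (K + 1))) := mul_le_mul_of_nonneg_left hsmall (by linarith)
      _ = C_G / 2 := by field_simp
  have hR : C_G / 2 ≤ C_G * (1 + q ^ (-(n : ℝ))) / 2 := by nlinarith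
  linarith

/-- **Selection of the behind threshold `kb`, exponential-envelope form** (appended by p1 g9; this is the
form the assembly needs, because the front block's start energy — hence the bound `2√E₁` on the block
neighbour of the shell `kb` — itself grows like `q^{−2 kb}` as `kb → −∞` under `TameBehind`): for
`q > 1`, `C_G > 0`, `τ, Cα ≥ 0` and any real `C₁` there is `kb ≤ −1` with
`τ · (2 Cα q^{5n/2} (C₁ q^{−n}) (C₁ q^{−n})) ≤ C_G (1 + q^{−n}) / 2` for every `n ≤ kb`
(the left side is `2 τ Cα C₁² q^{n/2}`). Use with `Ĝ n := C₁ q^{−n}`, `C₁ := 6 C_G q + 2 √E⋆`, where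
`E₁(kb) ≤ E⋆ q^{−2kb}` bounds the block start energy. [folklore] -/
theorem exists_kb_behind_condition' {q C_G C₁ τ Cα : ℝ} (hq : 1 < q) (hC : 0 < C_G)
    (hτ : 0 ≤ τ) (hCα : 0 ≤ Cα) :
    ∃ kb : ℤ, kb ≤ -1 ∧ ∀ n : ℤ, n ≤ kb →
      τ * (2 * Cα * q ^ ((5 : ℝ) * n / 2) * (C₁ * q ^ (-(n : ℝ))) * (C₁ * q ^ (-(n : ℝ)))) ≤
        C_G * (1 + q ^ (-(n : ℝ))) / 2 := by
  have hq0 : 0 < q := by linarith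
  set K : ℝ := 2 * τ * Cα * C₁ ^ 2 with hK
  have hK0 : 0 ≤ K := by positivity
  obtain ⟨N, hN⟩ := exists_rpow_mul_le_atBot hq (by norm_num : (0 : ℝ) < 1 / 2)
    (div_pos hC (by positivity : (0 : ℝ) < 2 * (K + 1)))
  refine ⟨min N (-1), min_le_right _ _, fun n hn => ?_⟩
  have hnN : n ≤ N := hn.trans (min_le_left _ _)
  have hpn : 0 ≤ q ^ (-(n : ℝ)) := (Real.rpow_pos_of_pos hq0 _).le
  -- q^{5n/2} (q^{-n})² = q^{n/2}
  have hpow : q ^ ((5 : ℝ) * n / 2) * (q ^ (-(n : ℝ))) ^ 2 = q ^ ((1 / 2 : ℝ) * n) := by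
    rw [← Real.rpow_mul_natCast hq0.le, ← Real.rpow_add hq0]; push_cast; ring_nf
  have hL : τ * (2 * Cα * q ^ ((5 : ℝ) * n / 2) * (C₁ * q ^ (-(n : ℝ))) * (C₁ * q ^ (-(n : ℝ)))) =
      K * q ^ ((1 / 2 : ℝ) * n) := by
    rw [← hpow, hK]; ring
  rw [hL]
  have hsmall := hN n hnN
  have hKq : K * q ^ ((1 / 2 : ℝ) * n) ≤ C_G / 2 := by
    have hh : 0 ≤ q ^ ((1 / 2 : ℝ) * n) := (Real.rpow_pos_of_pos hq0 _).le
    calc K * q ^ ((1 / 2 : ℝ) * n) ≤ (K + 1) * q ^ ((1 / 2 : ℝ) * n) := by nlinarith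
      _ ≤ (K + 1) * (C_G / (2 * (K + 1))) := mul_le_mul_of_nonneg_left hsmall (by linarith)
      _ = C_G / 2 := by field_simp
  nlinarith

/-- **Geometric bound for the block start energy behind the front**: for `q > 1` and `kb ≤ 0`,
`∑_{j < L} q^{2 (L − 1 − j)}`-type sums are controlled by the top term; in the form used by the assembly:
`∑_{k ∈ [kb+1, 0]} q^{−2k} ≤ q^{−2 kb} / (q² − 1) · q²`… stated simply as: for every `n : ℕ`,
`∑_{j < n} q^{2 j} ≤ q^{2 n} / (q^2 − 1)`. [folklore] -/
theorem geom_sum_sq_le {q : ℝ} (hq : 1 < q) (n : ℕ) :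
    ∑ j ∈ Finset.range n, q ^ (2 * j) ≤ q ^ (2 * n) / (q ^ 2 - 1) := by
  have hq2 : 1 < q ^ 2 := by nlinarith
  have hpos : 0 < q ^ 2 - 1 := by linarith
  have h := geom_sum_eq (x := q ^ 2) (by linarith : q ^ 2 ≠ 1) n
  have hre : ∑ j ∈ Finset.range n, q ^ (2 * j) = ∑ j ∈ Finset.range n, (q ^ 2) ^ j := by
    refine Finset.sum_congr rfl fun j _ => ?_
    rw [pow_mul]
  rw [hre, h, div_le_div_iff_of_pos_right hpos, ← pow_mul]
  have : 0 ≤ (1 : ℝ) := zero_le_one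
  nlinarith [pow_pos (by linarith : (0 : ℝ) < q) (2 * n)]

/-- **Selection for the bottom flux of the front block** (memo §10 (4), second half): for `q > 1`,
`c, C₀ ≥ 0`, any `C₁`, there is `kb ≤ −1` with `c · (q^{5n/2} (C₁ q^{−n})² · 2 · C₀) ≤ 1/4` for all `n ≤ kb`;
multiplying by `E₁ ≥ √E₁` (when `E₁ ≥ 1`) gives the bottom-flux half of `hcondBlock` of
`pseudoFlowOn_block_and_behind`. [folklore] -/
theorem exists_kb_bottom_flux {q c C₀ C₁ : ℝ} (hq : 1 < q) (hc : 0 ≤ c) (hC₀ : 0 ≤ C₀) :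
    ∃ kb : ℤ, kb ≤ -1 ∧ ∀ n : ℤ, n ≤ kb →
      c * ((1 : ℝ) * q ^ ((5 : ℝ) * n / 2) * (C₁ * q ^ (-(n : ℝ))) ^ 2 * 2 * C₀) ≤ 1 / 4 := by
  have hq0 : 0 < q := by linarith
  set K : ℝ := 2 * c * C₀ * C₁ ^ 2 with hK
  have hK0 : 0 ≤ K := by positivity
  obtain ⟨N, hN⟩ := exists_rpow_mul_le_atBot hq (by norm_num : (0 : ℝ) < 1 / 2)
    (by positivity : (0 : ℝ) < 1 / (4 * (K + 1)))
  refine ⟨min N (-1), min_le_right _ _, fun n hn => ?_⟩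
  have hnN : n ≤ N := hn.trans (min_le_left _ _)
  have hpow : q ^ ((5 : ℝ) * n / 2) * (q ^ (-(n : ℝ))) ^ 2 = q ^ ((1 / 2 : ℝ) * n) := by
    rw [← Real.rpow_mul_natCast hq0.le, ← Real.rpow_add hq0]; push_cast; ring_nf
  have hL : c * ((1 : ℝ) * q ^ ((5 : ℝ) * n / 2) * (C₁ * q ^ (-(n : ℝ))) ^ 2 * 2 * C₀) =
      K * q ^ ((1 / 2 : ℝ) * n) := by
    rw [← hpow, hK]; ring
  rw [hL]
  have hh : 0 ≤ q ^ ((1 / 2 : ℝ) * n) := (Real.rpow_pos_of_pos hq0 _).le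
  calc K * q ^ ((1 / 2 : ℝ) * n) ≤ (K + 1) * q ^ ((1 / 2 : ℝ) * n) := by nlinarith
    _ ≤ (K + 1) * (1 / (4 * (K + 1))) := mul_le_mul_of_nonneg_left (hN n hnN) (by linarith)
    _ = 1 / 4 := by field_simp

end GappedFrontRobust

end Summit.NavierStokesRegularity.NavierStokesRegularity.Theorems

end
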